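import Summits.QuantumFields.BalabanUV.Beta.FP.ConstrainedBiLaplacianFibreSides

/-!
# `BalabanUV.Beta.FP.ConstrainedBiLaplacianFibreIdentities` — road «FP» for binder row D1, DESIGN ROW **GHOST-STEP** brick (g3) «(CONV-C)-Sb»
# (owner d1-p3 gen 13, Q-FP-13-2 → gan24-p3), FILE 2 — THE TWO FIBRE IDENTITIES OF THE REGROUPED ENTRIES `Gfib` ON THE WHOLE STRIP:
# `(Δ^ξ(p′+2πk))^s · Gfib k k′ = δ_{kk′} − u_k · c_{k′}` (the EULER–LAGRANGE ROW with a RANK-ONE, i.e. BLOCK-CONSTANT, multiplier) and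
# `Σ_k ũ_k · Gfib k k′ = 0` (ZERO BLOCK SUMS) — with NO division by the unshifted symbol `Δ^ξ(p′)`, hence valid through `p′ = 0`

NOT IN PRINT; OUR PROOF ATTEMPT (binder row G-an2-4 ∕ (CONV-C), prover part P3 = fibre∕strip «Woodbury» lineage, gen 28; CRUX TEAM (2),
2026-08-21).  HONEST DEPENDENCY (cell records, verbatim): «continuum YM on T⁴ ⇐ BetaPertH ∧ nine spine estimates (0/9 proved); BetaPertH ⇐ (D1) ∧
(D4) ∧ CAP+tail; G-an2-4 gates asym, D1 and NE2/3/4.»  HONEST FRAMING (cell contract, verbatim): «discharging `BetaPertH` makes Bałaban's UV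
stability UNCONDITIONAL — a real constructive-QFT result; it is NOT the continuum limit and NOT the Clay problem.»  ABSOLUTE RULE (cell charter,
verbatim): «No internally-minted statement may enter as a cited fact. Every hypothesis is either kernel-proved in this package or a verbatim quotation
of a PUBLISHED theorem with page reference. The manuscript(s) under audit are NOT citable for their own disputed steps — they are the thing under
adjudication; programme-internal (2001/route/tribunal) claims are never citable.»  THIS MODULE is [folklore] algebra over the lineage's FILES 1, 2a, 2b,
3a of row RHOA-4-GH (`ConstrainedBiLaplacianStrip.den`∕`den_eq_U_add_mul_Spr`∕`den_ne_zero_strip`, `ConstrainedBiLaplacianFibre.{vc, Fc, ainv, Spr}`,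
`ConstrainedBiLaplacianFibreEntries.{side, coef, Gfib}`, `ConstrainedBiLaplacianFibreSides.v_mul_vc_eq_uFactor`) and the vendored one-coordinate
factors of `B4StripSums` ∕ `B4StripCauchy` (`v`, `w`, `ef`, `v_eq_quotient`, `w_ne_one`, `Sxi_shift_ne_zero`); it re-defines no symbol of [B4], cites
nothing as a hypothesis, has ONE bookkeeping `def` (`cvec`, the rank-one co-vector), no `def … : Prop`, no `sorry`.

## Why (the junction programme behind Q-FP-13-2, journal INTENT «SB-CELL» 2026-08-21)

an2's block-constrained bi-Laplacian Green kernel `BiLaplaceBlockKKT.Sb` is CANONICAL (`BiLaplaceBlockGreen.eq_Sb_of_solvesB`): any tempered pair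
`(λ, ω)` solving `L(Lλ) = ω ∘ quo_N + δ_{x′}`, `blockSum_N λ = 0` IS `(Sb(·,x′), Wb(·,x′))`.  The lineage's fibre kernel `latticeKernel (M N s τ σ)`
(FILE 3b) is, entry by entry, the zone integral of `N^{−d}Σ_{kk′} EF(τ,k)·EFc(σ,k′)·Gfib k k′`; acting with the fine Laplacian on the left fine
variable multiplies the alias-`k` phase by `−N^{−2}·Δ^ξ(p′+2πk)`, and summing the left fine variable over a block replaces `EF(·,k)` by
`N^{d+1}·ũ_k = N^{d+1}·Fc N 0 k`.  So the two identities of THIS file are exactly the fibre content of an2's two rows: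
* **`symbol_mul_Gfib`** (§3): `(Δ^ξ(p′+2πk))^s · Gfib n s k k′ p′ = [k = k′] − F n 0 k p′ · cvec n s k′ p′` for EVERY `k, k′` and every `p′` in
  `Strip d (kappaB d s)` — the `δ` is the unit force, the rank-one term `u_k·c_{k′}` (with `u_k = F n 0 k` the block-averaging factor) is a
  multiplier CONSTANT on blocks in the left variable; the co-vector `cvec` (§2) is regular through `p′ = 0` (it carries `Δ^ξ(p′)^s` only as a
  FACTOR, never as a divisor) — this is the regrouping of FILE 2b read backwards;
* **`sum_Fc_mul_Gfib`** (§3): `Σ_k Fc n 0 k p′ · Gfib n s k k′ p′ = 0` for every `k′` — zero block sums of every column (`⟨ũ|𝒢 = 0` of FILE 2a §0,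
  now for the REGROUPED entries on the whole strip, by `den = U_0 + (Δ^ξ)^s·Spr`).
Input of independent use (§1): **`v_mul_vc_eq_uFactor_shift`** (`v n j z · vc n j z = uFactor n j z` for `1 ≤ j ≤ n − 1` on `|Re z| ≤ π + r`,
`r ≤ 1∕4` — FILE 3a had the residue `j = 0`) and **`F_zero_mul_Fc_zero_eq_U_all`** (`F n 0 k p′ · Fc n 0 k p′ = U n k p′` for EVERY alias `k` on the
fat region `Fat d r`, `r ≤ 1∕4` — the continued `|u(p′+2πk)|²` of [B4] (2.45) IS the product of the block-averaging factor and its conjugate partner).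

§4 (for the `Sb` junction): `norm_cvec_le` (`‖cvec_{k′}‖ ≤ CG d s·wt n s k′` on the strip), `differentiableAt_cvec`, `cvec_eq_unregrouped`
(`= ũ_{k′}∕(A_{k′}·Ssum)` off the zeros of `Δ^ξ`), `cvec_tr_side` (side periodicity `cvec (p+2πe_μ) k′ = cvec p (σ_μ k′)`).

NOT HERE (FILE 3 of the programme, same lineage): the fine-lattice Fourier representation of `latticeKernel (M N s · ·)`, the action of an2's
`codiff₁ ∘ dz` and `blockSum` on it, temperedness, and the junction `Sb = N^{2s}·latticeKernel (M N 2 · ·)` by `eq_Sb_of_solvesB`.  0∕4 row-D1 binders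
touched.  NOT (CONV-C), NEVER «G-an2-4 closed», NOT the ghost step law, NOT SDF, NOT D1, NOT BetaPertH, NOT continuum, NOT Clay.  Provenance:
prover-b2b-balaban-gan24-p3-g28-0 (unit `b2b-balaban-gan24-p3`, gen 28), 2026-08-21; no existing file touched.
-/

noncomputable section

namespace Summit.QuantumFields.BalabanUV.Beta.FP.ConstrainedBiLaplacianFibreIdentities

open Complex Finset ComplexConjugate
open Literature.MathematicalPhysics.QuantumFieldTheory.Balaban1983to89
open Literature.MathematicalPhysics.QuantumFieldTheory.Balaban1983to89.B4Strip
open Literature.MathematicalPhysics.QuantumFieldTheory.Balaban1983to89.B4StripCauchy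
open Literature.MathematicalPhysics.QuantumFieldTheory.Balaban1983to89.B5Strip145Analytic
open Literature.MathematicalPhysics.QuantumFieldTheory.Balaban1983to89.B4StripSums
open Summit.QuantumFields.BalabanUV.Beta.FP.ConstrainedBiLaplacianStrip
open Summit.QuantumFields.BalabanUV.Beta.FP.ConstrainedBiLaplacianFibre
open Summit.QuantumFields.BalabanUV.Beta.FP.ConstrainedBiLaplacianFibreEntries
open Summit.QuantumFields.BalabanUV.Beta.FP.ConstrainedBiLaplacianFibreSides
open scoped Real

variable {d : ℕ}

/-! ## §1 The continued `|u|²` at every alias: `v·vc = uFactor`, `F n 0 k · Fc n 0 k = U n k` -/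

/-- [folklore] The conjugate block-averaging factor in closed form at ANY residue: `vc n j z = (e^{iz} − 1)∕(n (e^{i(z+2πj)∕n} − 1))`
whenever the geometric ratio at `conj z` is not `1` (conjugate of `B4StripSums.v_eq_quotient`). -/
theorem vc_eq_quotient (n j : ℕ) (hn : n ≠ 0) {z : ℂ} (hw : w n j (conj z) ≠ 1) :
    vc n j z = (cexp (I * z) - 1) / ((n : ℂ) * (cexp (I * (z + 2 * π * j) / n) - 1)) := by
  rw [vc_eq_conj, v_eq_quotient n j hn hw, map_div₀, map_sub, map_one, map_mul, map_natCast, map_sub, map_one, conj_w_conj,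
    ← Complex.exp_conj, map_neg, map_mul, Complex.conj_I, Complex.conj_conj]
  congr 2
  ring

/-- [folklore] **THE CONTINUED `u·ū = |u|²` IN ONE COORDINATE AT A NONZERO RESIDUE**: for `1 ≤ j ≤ n − 1`, `r ≤ 1∕4` and `|Re z| ≤ π + r`,
`v n j z · vc n j z = uFactor n j z` (`= S₁(z)∕S_ξ(z+2πj)`; the two geometric sums in closed form, `B4StripCauchy.Sxi_shift_ne_zero`). -/
theorem v_mul_vc_eq_uFactor_shift (n j : ℕ) (hj : 1 ≤ j) (hjn : j + 1 ≤ n) {z : ℂ} {r : ℝ} (hr : r ≤ 1 / 4)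
    (hx : |z.re| ≤ Real.pi + r) : v n j z * vc n j z = uFactor n j z := by
  have hn0 : n ≠ 0 := by omega
  have hnC : (n : ℂ) ≠ 0 := Nat.cast_ne_zero.mpr hn0
  have hS : Sxi n (z + 2 * Real.pi * (j : ℂ)) ≠ 0 := Sxi_shift_ne_zero n j hj hjn hr hx
  have hSc : Sxi n (conj z + 2 * Real.pi * (j : ℂ)) ≠ 0 :=
    Sxi_shift_ne_zero n j hj hjn hr (by rwa [Complex.conj_re])
  have hw : w n j z ≠ 1 := w_ne_one n j hS
  have hwc : w n j (conj z) ≠ 1 := w_ne_one n j hSc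
  have huf : uFactor n j z = S1 z / Sxi n (z + 2 * Real.pi * (j : ℂ)) := by
    unfold uFactor
    rw [if_neg (by omega)]
  rw [v_eq_quotient n j hn0 hw, vc_eq_quotient n j hn0 hwc, huf, Sxi_eq_sq_mul_S1, S1_eq_mul z,
    S1_eq_mul ((z + 2 * Real.pi * (j : ℂ)) / n)]
  have hwdef : w n j z = cexp (-(I * ((z + 2 * Real.pi * (j : ℂ)) / n))) := by
    unfold w; congr 1; ring
  have e1 : cexp (I * (z + 2 * π * j) / n) = cexp (I * ((z + 2 * Real.pi * (j : ℂ)) / n)) := by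
    congr 1; ring
  rw [hwdef, e1]
  have hd1 : cexp (-(I * ((z + 2 * Real.pi * (j : ℂ)) / n))) - 1 ≠ 0 := by rw [← hwdef]; exact sub_ne_zero.mpr hw
  have hd2 : cexp (I * ((z + 2 * Real.pi * (j : ℂ)) / n)) - 1 ≠ 0 := by
    intro h
    apply hd1
    have h1 : cexp (I * ((z + 2 * Real.pi * (j : ℂ)) / n)) = 1 := sub_eq_zero.mp h
    rw [Complex.exp_neg, h1, inv_one, sub_self]
  field_simp

/-- [folklore] **`F n 0 k p · Fc n 0 k p = U n k p` FOR EVERY ALIAS `k`** on the fat region `Fat d r`, `r ≤ 1∕4` (coordinates with `k_ν = 0` by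
FILE 3a's `v_mul_vc_eq_uFactor`, the others by `v_mul_vc_eq_uFactor_shift`; the sub-lattice phases at offset `0` are `1`). -/
theorem F_zero_mul_Fc_zero_eq_U_all (n : ℕ) [NeZero n] {r : ℝ} (hr : r ≤ 1 / 4) {p : Fin d → ℂ} (hp : p ∈ Fat d r)
    (k : Fin d → Fin n) : F n (fun _ => 0) k p * Fc n (fun _ => 0) k p = U n k p := by
  have hn : 1 ≤ n := Nat.one_le_iff_ne_zero.mpr (NeZero.ne n)
  unfold F Fc U
  rw [← Finset.prod_mul_distrib]
  refine Finset.prod_congr rfl fun ν _ => ?_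
  have h1 : ef n (k ν : ℕ) ((fun _ => (0 : Fin n)) ν : ℕ) (p ν) = 1 := by unfold ef; simp
  have h2 : efc n (k ν : ℕ) ((fun _ => (0 : Fin n)) ν : ℕ) (p ν) = 1 := by unfold efc; simp
  rw [h1, h2, one_mul, one_mul]
  have hre : |(p ν).re| ≤ Real.pi + r := (hp ν).1
  by_cases hk : (k ν : ℕ) = 0
  · rw [hk]
    exact v_mul_vc_eq_uFactor n hn (by linarith [Real.pi_gt_three])
  · exact v_mul_vc_eq_uFactor_shift n (k ν) (Nat.one_le_iff_ne_zero.mpr hk) (by have := (k ν).isLt; omega) hr hre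

/-- [folklore] The strip of FILE 1 lies in the fat region of radius `rOf d` (`B4StripCauchy.strip_subset_fat`). -/
theorem fat_of_strip (s : ℕ) {p : Fin d → ℂ} (hp : p ∈ Strip d (kappaB d s)) : p ∈ Fat d (rOf d) :=
  strip_subset_fat (rOf_pos d).le (kappaB_le_rOf d s) hp

/-- [folklore] On the strip: `F n 0 k · Fc n 0 k = U n k` for every alias. -/
theorem F_zero_mul_Fc_zero_eq_U_strip (n : ℕ) [NeZero n] (s : ℕ) {p : Fin d → ℂ} (hp : p ∈ Strip d (kappaB d s))
    (k : Fin d → Fin n) : F n (fun _ => 0) k p * Fc n (fun _ => 0) k p = U n k p :=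
  F_zero_mul_Fc_zero_eq_U_all n (rOf_le d) (fat_of_strip s hp) k

/-- [folklore] On the strip the SHIFTED symbols do not vanish: `Δ^ξ(p′+2πk) ≠ 0` for `k ≠ 0` (`B4StripSums.DeltaXi_shift_ne_zero`). -/
theorem symbol_shift_ne_zero (n : ℕ) [NeZero n] (s : ℕ) {p : Fin d → ℂ} (hp : p ∈ Strip d (kappaB d s))
    {k : Fin d → Fin n} (hk : k ≠ fun _ => 0) : DeltaXi n 0 (shift n k p) ≠ 0 :=
  DeltaXi_shift_ne_zero n 0 le_rfl (rOf_le d) (d_mul_rOf_sq_le d) (fat_of_strip s hp) k hk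

/-- [folklore] Hence `(Δ^ξ(p′+2πk))^s · ainv n s k p′ = 1` for `k ≠ 0` on the strip. -/
theorem symbol_pow_mul_ainv (n : ℕ) [NeZero n] (s : ℕ) {p : Fin d → ℂ} (hp : p ∈ Strip d (kappaB d s))
    {k : Fin d → Fin n} (hk : k ≠ fun _ => 0) : DeltaXi n 0 (shift n k p) ^ s * ainv n s k p = 1 := by
  unfold ainv
  exact mul_inv_cancel₀ (pow_ne_zero s (symbol_shift_ne_zero n s hp hk))

/-! ## §2 The four cases of the regrouped entries and the rank-one co-vector -/

section Entries

variable (n : ℕ) [NeZero n] (s : ℕ) (p : Fin d → ℂ)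

/-- [folklore] `Gfib 0 0 = Spr∕den`. -/
theorem Gfib_zero_zero : Gfib n s (fun _ => 0) (fun _ => 0) p = Spr n s p / den n s p := by
  unfold Gfib
  rw [if_pos ⟨rfl, rfl⟩]

/-- [folklore] `Gfib 0 k′ = −u_0 ũ_{k′} a_{k′}∕den` for `k′ ≠ 0`. -/
theorem Gfib_zero_left {k' : Fin d → Fin n} (hk' : k' ≠ fun _ => 0) :
    Gfib n s (fun _ => 0) k' p = -(F n (fun _ => 0) (fun _ => 0) p * Fc n (fun _ => 0) k' p * (ainv n s k' p / den n s p)) := by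
  unfold Gfib coef side
  rw [if_neg (fun h => hk' h.2), if_neg (fun h : (fun _ => (0 : Fin n)) = k' => hk' h.symm), if_neg (fun h => h.1 rfl),
    if_pos rfl, if_neg hk']
  ring

/-- [folklore] `Gfib k 0 = −u_k ũ_0 a_k∕den` for `k ≠ 0`. -/
theorem Gfib_zero_right {k : Fin d → Fin n} (hk : k ≠ fun _ => 0) :
    Gfib n s k (fun _ => 0) p = -(F n (fun _ => 0) k p * Fc n (fun _ => 0) (fun _ => 0) p * (ainv n s k p / den n s p)) := by
  unfold Gfib coef side
  rw [if_neg (fun h => hk h.1), if_neg hk, if_neg (fun h => h.2 rfl), if_neg hk, if_pos rfl]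
  ring

/-- [folklore] `Gfib k k′ = [k = k′] a_k − u_k ũ_{k′} (Δ^ξ)^s a_k a_{k′}∕den` for `k, k′ ≠ 0`. -/
theorem Gfib_of_ne {k k' : Fin d → Fin n} (hk : k ≠ fun _ => 0) (hk' : k' ≠ fun _ => 0) :
    Gfib n s k k' p = (if k = k' then ainv n s k p else 0)
      - F n (fun _ => 0) k p * Fc n (fun _ => 0) k' p * (DeltaXi n 0 p ^ s * ainv n s k p * ainv n s k' p / den n s p) := by
  unfold Gfib coef side
  rw [if_neg (fun h => hk h.1), if_pos (show (k ≠ fun _ => (0 : Fin n)) ∧ k' ≠ fun _ => (0 : Fin n) from ⟨hk, hk'⟩),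
    if_neg hk, if_neg hk']

/-- [folklore] **THE RANK-ONE CO-VECTOR** `c_{k′}` of the Euler–Lagrange row: `c_0 = ũ_0∕den`, `c_{k′} = (Δ^ξ)^s ũ_{k′} a_{k′}∕den` (`k′ ≠ 0`) —
`(Δ^ξ(p′))^s` enters as a FACTOR only, so `c` is holomorphic through `p′ = 0`. -/
def cvec (k' : Fin d → Fin n) : ℂ :=
  (if k' = fun _ => (0 : Fin n) then 1 else DeltaXi n 0 p ^ s) * side n s k' p * Fc n (fun _ => 0) k' p / den n s p

/-- [folklore] `c_0 = ũ_0∕den`. -/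
theorem cvec_zero : cvec n s p (fun _ => 0) = Fc n (fun _ => 0) (fun _ => 0) p / den n s p := by
  unfold cvec side
  rw [if_pos rfl, if_pos rfl, one_mul, one_mul]

/-- [folklore] `c_{k′} = (Δ^ξ)^s ũ_{k′} a_{k′}∕den` for `k′ ≠ 0`. -/
theorem cvec_of_ne {k' : Fin d → Fin n} (hk' : k' ≠ fun _ => 0) :
    cvec n s p k' = DeltaXi n 0 p ^ s * ainv n s k' p * Fc n (fun _ => 0) k' p / den n s p := by
  unfold cvec side
  rw [if_neg hk', if_neg hk']

end Entries

/-! ## §3 The two fibre identities on the strip -/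

/-- [folklore] **THE EULER–LAGRANGE ROW IN THE FIBRE** (FILE 2a §0 `𝒢A = 1 − |u⟩⟨c|` for the REGROUPED entries, whole strip):
`(Δ^ξ(p′+2πk))^s · Gfib n s k k′ p′ = [k = k′] − F n 0 k p′ · cvec n s p′ k′` for all `k, k′`, all `p′ ∈ Strip d (kappaB d s)`. -/
theorem symbol_mul_Gfib (n : ℕ) [NeZero n] (s : ℕ) {p : Fin d → ℂ} (hp : p ∈ Strip d (kappaB d s)) (k k' : Fin d → Fin n) :
    DeltaXi n 0 (shift n k p) ^ s * Gfib n s k k' p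
      = (if k = k' then 1 else 0) - F n (fun _ => 0) k p * cvec n s p k' := by
  have hden : den n s p ≠ 0 := den_ne_zero_strip n s hp
  have hU0 : F n (fun _ => 0) (fun _ => (0 : Fin n)) p * Fc n (fun _ => 0) (fun _ => (0 : Fin n)) p = U n (fun _ => (0 : Fin n)) p :=
    F_zero_mul_Fc_zero_eq_U_strip n s hp _
  by_cases hk : k = fun _ => 0
  · subst hk
    rw [shift_zero]
    by_cases hk' : k' = fun _ => 0
    · subst hk'
      rw [Gfib_zero_zero, cvec_zero, if_pos rfl]
      have e : F n (fun _ => 0) (fun _ => (0 : Fin n)) p * (Fc n (fun _ => 0) (fun _ => (0 : Fin n)) p / den n s p)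
          = U n (fun _ => (0 : Fin n)) p / den n s p := by
        rw [← hU0, mul_div_assoc]
      rw [e, eq_sub_iff_add_eq, mul_div_assoc', ← add_div, div_eq_one_iff_eq hden, den_eq_U_add_mul_Spr]
      ring
    · rw [Gfib_zero_left n s p hk', cvec_of_ne n s p hk', if_neg (fun h : (fun _ => (0 : Fin n)) = k' => hk' h.symm)]
      ring
  · have hA : DeltaXi n 0 (shift n k p) ^ s * ainv n s k p = 1 := symbol_pow_mul_ainv n s hp hk
    by_cases hk' : k' = fun _ => 0
    · subst hk'
      rw [Gfib_zero_right n s p hk, cvec_zero, if_neg hk]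
      linear_combination (-(F n (fun _ => 0) k p * Fc n (fun _ => 0) (fun _ => (0 : Fin n)) p / den n s p)) * hA
    · rw [Gfib_of_ne n s p hk hk', cvec_of_ne n s p hk']
      by_cases hkk : k = k'
      · rw [if_pos hkk, if_pos hkk]
        linear_combination
          (1 - F n (fun _ => 0) k p * Fc n (fun _ => 0) k' p * DeltaXi n 0 p ^ s * ainv n s k' p / den n s p) * hA
      · rw [if_neg hkk, if_neg hkk]
        linear_combination
          (-(F n (fun _ => 0) k p * Fc n (fun _ => 0) k' p * DeltaXi n 0 p ^ s * ainv n s k' p / den n s p)) * hA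

/-- [folklore] **ZERO BLOCK SUMS IN THE FIBRE** (FILE 2a §0 `⟨ũ|𝒢 = 0` for the REGROUPED entries, whole strip):
`Σ_k Fc n 0 k p′ · Gfib n s k k′ p′ = 0` for every `k′` and every `p′ ∈ Strip d (kappaB d s)` (`den = U_0 + (Δ^ξ)^s·Spr`, `u_kũ_k = U_k`). -/
theorem sum_Fc_mul_Gfib (n : ℕ) [NeZero n] (s : ℕ) {p : Fin d → ℂ} (hp : p ∈ Strip d (kappaB d s)) (k' : Fin d → Fin n) :
    ∑ k : Fin d → Fin n, Fc n (fun _ => 0) k p * Gfib n s k k' p = 0 := by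
  have hden : den n s p ≠ 0 := den_ne_zero_strip n s hp
  have hU : ∀ k : Fin d → Fin n, F n (fun _ => 0) k p * Fc n (fun _ => 0) k p = U n k p := F_zero_mul_Fc_zero_eq_U_strip n s hp
  have h0 : (fun _ => (0 : Fin n)) ∈ (Finset.univ : Finset (Fin d → Fin n)) := Finset.mem_univ _
  rw [← Finset.add_sum_erase Finset.univ _ h0]
  by_cases hk' : k' = fun _ => 0
  · subst hk'
    rw [Gfib_zero_zero]
    have e : ∀ k ∈ Finset.univ.erase (fun _ => (0 : Fin n)), Fc n (fun _ => 0) k p * Gfib n s k (fun _ => 0) p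
        = -(Fc n (fun _ => 0) (fun _ => (0 : Fin n)) p / den n s p) * (U n k p * ainv n s k p) := fun k hk => by
      rw [Gfib_zero_right n s p (Finset.ne_of_mem_erase hk), ← hU k]
      ring
    rw [Finset.sum_congr rfl e, ← Finset.mul_sum]
    unfold Spr
    ring
  · rw [Gfib_zero_left n s p hk']
    have e : ∀ k ∈ Finset.univ.erase (fun _ => (0 : Fin n)), Fc n (fun _ => 0) k p * Gfib n s k k' p
        = (if k = k' then Fc n (fun _ => 0) k p * ainv n s k p else 0)
          - (Fc n (fun _ => 0) k' p * DeltaXi n 0 p ^ s * ainv n s k' p / den n s p) * (U n k p * ainv n s k p) := fun k hk => by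
      rw [Gfib_of_ne n s p (Finset.ne_of_mem_erase hk) hk', ← hU k]
      split_ifs <;> ring
    rw [Finset.sum_congr rfl e, Finset.sum_sub_distrib, Finset.sum_ite_eq' (Finset.univ.erase (fun _ => (0 : Fin n))) k',
      if_pos (Finset.mem_erase.mpr ⟨hk', Finset.mem_univ _⟩), ← Finset.mul_sum]
    have hden' := den_eq_U_add_mul_Spr n s p
    unfold Spr at hden'
    set S := ∑ k ∈ Finset.univ.erase (fun _ => (0 : Fin n)), U n k p * ainv n s k p with hS
    have key : Fc n (fun _ => 0) (fun _ => (0 : Fin n)) p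
          * -(F n (fun _ => 0) (fun _ => (0 : Fin n)) p * Fc n (fun _ => 0) k' p * (ainv n s k' p / den n s p))
        = -(U n (fun _ => (0 : Fin n)) p * Fc n (fun _ => 0) k' p * ainv n s k' p / den n s p) := by
      rw [← hU (fun _ => 0)]
      ring
    have key2 : -(U n (fun _ => (0 : Fin n)) p * Fc n (fun _ => 0) k' p * ainv n s k' p / den n s p)
          + (Fc n (fun _ => 0) k' p * ainv n s k' p
              - Fc n (fun _ => 0) k' p * DeltaXi n 0 p ^ s * ainv n s k' p / den n s p * S)
        = Fc n (fun _ => 0) k' p * ainv n s k' p * (den n s p - (U n (fun _ => (0 : Fin n)) p + DeltaXi n 0 p ^ s * S))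
            / den n s p := by
      field_simp
      ring
    rw [key, key2, ← hden', sub_self, mul_zero, zero_div]


/-! ## §4 The co-vector: bounds, holomorphy, side periodicity (consumed by the `Sb` junction, FILES 5a∕5b) -/

/-- [folklore] **`‖cvec_{k′}‖ ≤ CG d s · wt n s k′` ON THE STRIP** (mirror of FILE 3's `norm_bvec_le`, `Fc` in place of `F`). -/
theorem norm_cvec_le (n : ℕ) [NeZero n] (s : ℕ) {p : Fin d → ℂ} (hp : p ∈ Strip d (kappaB d s)) (k : Fin d → Fin n) :
    ‖cvec n s p k‖ ≤ CG d s * wt n s k := by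
  have hn : 1 ≤ n := Nat.one_le_iff_ne_zero.mpr (NeZero.ne n)
  have hfat : p ∈ Fat d (rOf d) := fat_of_strip s hp
  have hcB := cB_pos d
  have hside := norm_side_le n s (rOf_le d) (d_mul_rOf_sq_le d) hfat k
  have hF := norm_Fc_zero_le n (rOf_le d) k hfat
  have hden := norm_inv_den_le_strip n s hp
  have hsw := sideWt_nonneg n s k
  have hprod : 0 ≤ ∏ ν, 12 / omega n (k ν) :=
    Finset.prod_nonneg fun ν _ => by have := omega_pos n (k ν) (k ν).isLt; positivity
  have hpre : ‖(if k = fun _ => (0 : Fin n) then (1 : ℂ) else DeltaXi n 0 p ^ s)‖ ≤ (16 * (d : ℝ)) ^ s + 1 := by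
    split_ifs
    · rw [norm_one]; have : (0 : ℝ) ≤ (16 * (d : ℝ)) ^ s := by positivity
      linarith
    · rw [norm_pow]
      have h := norm_DeltaXi_le n hn 0 le_rfl (rOf_le d) hfat
      rw [add_zero] at h
      have : ‖DeltaXi n 0 p‖ ^ s ≤ (16 * (d : ℝ)) ^ s := pow_le_pow_left₀ (norm_nonneg _) h s
      linarith
  unfold cvec
  rw [norm_div, norm_mul, norm_mul, div_eq_mul_inv, ← norm_inv]
  unfold CG wt
  rw [div_eq_mul_inv ((16 * (d : ℝ)) ^ s + 1)]
  calc ‖(if k = fun _ => (0 : Fin n) then (1 : ℂ) else DeltaXi n 0 p ^ s)‖ * ‖side n s k p‖ * ‖Fc n (fun _ => 0) k p‖ * ‖(den n s p)⁻¹‖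
      ≤ ((16 * (d : ℝ)) ^ s + 1) * sideWt n s k * (∏ ν, 12 / omega n (k ν)) * (cB d)⁻¹ :=
        mul_le_mul (mul_le_mul (mul_le_mul hpre hside (norm_nonneg _) (by positivity)) hF (norm_nonneg _) (by positivity))
          hden (norm_nonneg _) (by positivity)
    _ = ((16 * (d : ℝ)) ^ s + 1) * (cB d)⁻¹ * ((∏ ν, 12 / omega n (k ν)) * sideWt n s k) := by ring

/-- [folklore] `cvec n s · k` is holomorphic (jointly) at every point of the strip. -/
theorem differentiableAt_cvec (n : ℕ) [NeZero n] (s : ℕ) (k : Fin d → Fin n) {p : Fin d → ℂ} (hp : p ∈ Strip d (kappaB d s)) :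
    DifferentiableAt ℂ (fun q => cvec n s q k) p := by
  have hfat : p ∈ Fat d (rOf d) := fat_of_strip s hp
  have hpre : DifferentiableAt ℂ (fun q : Fin d → ℂ => (if k = fun _ => (0 : Fin n) then (1 : ℂ) else DeltaXi n 0 q ^ s)) p := by
    split_ifs
    · exact differentiableAt_const _
    · exact (differentiableAt_DeltaXi n 0 p).pow s
  show DifferentiableAt ℂ (fun q => (if k = fun _ => (0 : Fin n) then (1 : ℂ) else DeltaXi n 0 q ^ s) * side n s k q *
    Fc n (fun _ => 0) k q / den n s q) p
  exact dAt_div ((hpre.mul (differentiableAt_side n s (rOf_le d) (d_mul_rOf_sq_le d) hfat k)).mul (differentiableAt_Fc n _ k p))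
    (differentiableAt_den_strip n s hp) (den_ne_zero_strip n s hp)

/-- [folklore] The un-regrouped form of the co-vector off the zeros of `Δ^ξ`: `cvec_{k′} = ũ_{k′}∕(A_{k′}·Ssum)`. -/
theorem cvec_eq_unregrouped (n : ℕ) [NeZero n] (s : ℕ) {p : Fin d → ℂ} (k : Fin d → Fin n) (h0 : DeltaXi n 0 p ≠ 0)
    (hden : den n s p ≠ 0) (hk : ∀ j : Fin d → Fin n, DeltaXi n 0 (shift n j p) ≠ 0) :
    cvec n s p k = Fc n (fun _ => 0) k p / (DeltaXi n 0 (shift n k p) ^ s * Ssum n s p) := by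
  have hA0 : DeltaXi n 0 p ^ s ≠ 0 := pow_ne_zero s h0
  rw [← den_div_eq_Ssum n s h0]
  by_cases hk0 : k = fun _ => 0
  · subst hk0
    rw [cvec_zero, shift_zero]
    field_simp
  · have hAk : DeltaXi n 0 (shift n k p) ^ s ≠ 0 := pow_ne_zero s (hk k)
    rw [cvec_of_ne n s p hk0]
    unfold ainv
    field_simp

/-- [folklore] Side periodicity of the co-vector: `cvec (p + 2πe_μ) k = cvec p (σ_μ k)` at strip points with `Re p_μ = −π`. -/
theorem cvec_tr_side (n : ℕ) [NeZero n] (s : ℕ) {κ : ℝ} (hκ0 : 0 ≤ κ) (hκ : κ ≤ kappaB d s) {p : Fin d → ℂ}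
    (hp : p ∈ Strip d κ) (μ : Fin d) (hre : (p μ).re = -Real.pi) (k : Fin d → Fin n) :
    cvec n s (tr p μ) k = cvec n s p (sigma n μ k) := by
  have hπ := Real.pi_pos
  have hz : p μ ≠ 0 := by
    intro h; rw [h, Complex.zero_re] at hre; linarith
  have hz' : p μ + 2 * Real.pi ≠ 0 := by
    intro h
    have := congrArg Complex.re h
    rw [← tr_apply_self, tr_re_self, hre, Complex.zero_re] at this
    linarith
  have hp1 : tr p μ ∈ Strip d κ := tr_mem_Strip hp μ hre
  obtain ⟨h0, hden, hsh, -⟩ := unregrouped_hyps n s hκ0 hκ hp μ (by rw [hre, abs_neg, abs_of_pos hπ])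
  obtain ⟨h0', hden', hsh', -⟩ := unregrouped_hyps n s hκ0 hκ hp1 μ (by rw [tr_re_self, hre]; ring_nf; exact abs_of_pos hπ)
  rw [cvec_eq_unregrouped n s k h0' hden' hsh', cvec_eq_unregrouped n s (sigma n μ k) h0 hden hsh, Ssum_tr n s p μ hz hz', Fc_tr,
    DeltaXi_shift_tr]

end Summit.QuantumFields.BalabanUV.Beta.FP.ConstrainedBiLaplacianFibreIdentities

end
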